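import Literature.AlgebraicGeometry.AbelianSchemes.AbelianSchemeQuotientPoincareIsotropyOfFibre   -- ★ §1–§4 (the `σ : K` originals)
import HarnessLib

/-!
# The `hiso` binder for an ARBITRARY `n`-torsion subgroup `K₂` of sections (the NON-LAGRANGIAN dual kernel `λ_*K₂` of `A/K`), from the
# `ē^Θ_n`-isotropy of `K₂` AGAINST `K` on geometric fibres ([MumfordAV1970] §15 Thm. 1, §23 Thm. 2; [MilneAV2008] I §8–§9)

Topic `AlgebraicGeometry/AbelianSchemes`, namespace `Literature.AlgebraicGeometry.AbelianSchemes.AbelianSchemeOver`.  THEOREMS ONLY (no definition, no named fact,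
no instance, no notation, no `sorry`).  Cell `hodgecm-mathlib` (D-0151), F0∕P6 «MOD» line L3 (socket `stub_FROB`, road ROOF → `stub_ROOF0`, LA3-plan (g0) RULING «DUAL-B̄» #3,
head (H3) of LA6-p03 (g0)'s census).  ★ `AbelianSchemeQuotientPoincareIsotropyOfFibre` §3–§4 deliver the fibrewise clause `hiso` of the engine's stabiliser input for sections
`σ ∈ K` (the LAGRANGIAN dual kernel `λ_*K`); their proofs read `σ` only as an `n`-torsion section paired against `K`.  This file is the same two theorems with `σ` ranging
over ANY subgroup `K₂ ≤ A(S)` killed by `n` — the input `hiso₂` of ★ (H2) `map_le_poincareStabilizerSubgroup_of_subgroup` (p849009) — from the ISOTROPY OF `K₂` AGAINST `K`: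
`ē^Θ_n(κ(s̄), σ(s̄)) = 1` for `κ ∈ K`, `σ ∈ K₂` (for `K = A[𝔟]`, `K₂ = A[n𝔟̄⁻¹]` this is the Rosati adjunction on torsion, the next organ).  `--supports
stmt-HodgeConjecture-24832`, count-neutral.  HONEST LABEL: HC_CM is proved only modulo the cell's 2 remaining named inputs (hLiu418 24832, h413 24833) until rung 0 closes;
this file discharges none of them.

* §1 `hiso_of_isLambdaOfAt_of_fibre_of_subgroup` — ★ §3 with `σ : K₂` (the Kummer-bridge output as hypothesis);
* §2 **`hiso_of_isLambdaOfAt_of_weilPairingLevel_eq_one_of_subgroup (K₂) (hK₂ : ∀ σ : K₂, σ ^ n = 1) (h : … ē^Θ_n(K, σ) = 1 …)`** — ★ §4 with `σ : K₂`: the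
  Kummer bridge ★ `nonempty_pullback_translateTensorDual_iso_unit_of_forall_weilPairingLevel_eq_one` needs only `σ(s̄) ∈ A_s̄[n]` (from `hK₂`) and the isotropy against
  `K(s̄) = ker ψ_s̄` — conclusion TOKEN FOR TOKEN the `hiso₂` binder of ★ (H2).

## References
* [MumfordAV1970] D. Mumford, *Abelian Varieties* (1970), §15 Thm. 1 (p. 143), §23 Thm. 2 (p. 231).
* [MilneAV2008] J. S. Milne, *Abelian Varieties* (2008), I §8 (pp. 36–37), I §9 Thm. 9.1 (p. 42).
-/

set_option autoImplicit false

noncomputable section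

-- `(A.fibre s).left = pullback A.X.hom s = (A.baseChange s).left` and `toSchemeHom (fibreHom π s) = (baseChangeHom π s).left`
-- hold by `rfl` only (as in ★ `AbelianSchemeQuotientPoincareIsotropyOfFibre`).
set_option backward.isDefEq.respectTransparency false

universe u

open CategoryTheory CategoryTheory.Limits AlgebraicGeometry MonoidalCategory CartesianMonoidalCategory
open scoped MonObj

namespace Literature.AlgebraicGeometry.AbelianSchemes.AbelianSchemeOver

open Literature.AlgebraicGeometry.Motives Literature.AlgebraicGeometry.AbelianVarieties Literature.AlgebraicGeometry.Modules

variable {S : Scheme.{u}} (A : AbelianSchemeOver S)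
  {Y : Scheme.{u}} (u : S ⟶ Y) (K : Subgroup A.Sections) [IsCommMonObj A.X] {n : ℕ}
  (hK : ∀ σ : K, (σ : A.Sections) ^ n = 1)
  [Finite K] [Y.IsSeparated] [IsSeparated (A.X.hom ≫ u)] [S.IsSeparated]
  (hcov : ∀ x : A.left, ∃ O : (A.translationActionOver u K).StableAffineOpens, x ∈ O.1)
  [LocallyOfFiniteType (A.X.hom ≫ u)] [IsLocallyNoetherian Y]
  (hG : ∃ _ : GrpObj (A.quotientOver u K), IsMonHom (A.quotientMk u K hcov))
  (hsm : Smooth (A.quotientOver u K).hom) (hgc : GeometricallyConnected (A.quotientOver u K).hom)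
  (D : A.DualPair) [IsAffine Y]
  (hfree : ∀ (Ω : Type u) [Field Ω] [IsAlgClosed Ω] (x : Spec (.of Ω) ⟶ A.left) (σ : K), σ ≠ 1 →
    x ≫ (A.translation (σ : A.Sections)).left ≠ x)

/-! ## §1 The `hiso₂` binder from the fibrewise Kummer statement, `σ ∈ K₂` -/

/-- **★ `hiso_of_isLambdaOfAt_of_fibre` FOR `σ ∈ K₂`**: if at every geometric point `s̄` and for every `σ ∈ K₂` there is a divisor `Θ` on `A_s̄` with `λ̄ = Λ(𝒪(Θ))` at `s̄` and
`π_s̄^*(t_{σ(s̄)}^*𝒪(Θ) ⊗ 𝒪(Θ)⁻¹) ≅ 𝒪` on `(A/K)_s̄`, then `(1_{A/K} × λσ(s̄))^*((π × 1_Â)^*𝒫) ≅ 𝒪` (★ §2′, per section).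
[cite: MumfordAV1970, §15 Thm. 1 (p. 143) and §23 (p. 231)] [cite: MilneAV2008, I §8 pp. 36–37] -/
theorem hiso_of_isLambdaOfAt_of_fibre_of_subgroup (lam : A.X ⟶ D.hat.X) (K₂ : Subgroup A.Sections)
    (h : ∀ (σ : K₂) ⦃Ω : Type u⦄ [Field Ω] [IsAlgClosed Ω] (s : Spec (.of Ω) ⟶ S),
      ∃ Θ : CartierDivisor (A.fibre s).toAbelianVariety.X.left, A.IsLambdaOfAt s D lam Θ ∧
        haveI := A.isMonHom_mulNDesc u K hK hcov hG hsm hgc hfree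
        Nonempty ((Scheme.Modules.pullback (AbelianVariety.Hom.toSchemeHom
            (fibreHom (A := A.quotientBy u K hcov hG hsm hgc) (B := A) (A.mulNDesc u K hK hcov) s))).obj
          (tensorObj
            ((Scheme.Modules.pullback ((A.fibre s).toAbelianVariety.translation
                (A.restrictPt s (σ : A.Sections))).left).obj (A.lineBundleOfDivisor s Θ))
            (Modules.dual (A.lineBundleOfDivisor s Θ))) ≅ SheafOfModules.unit _)) :
    ∀ (σ : K₂) ⦃Ω : Type u⦄ [Field Ω] [IsAlgClosed Ω] (s : Spec (.of Ω) ⟶ S),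
      Nonempty ((Scheme.Modules.pullback ((A.quotientBy u K hcov hG hsm hgc).baseChangeToProd D.hat s
          (D.hat.restrict s ((σ : A.Sections) ≫ lam)).left (Over.w _))).obj
        ((Scheme.Modules.pullback ((A.mulNDesc u K hK hcov : (A.quotientBy u K hcov hG hsm hgc).X ⟶ A.X) ▷ D.hat.X).left).obj
          D.P) ≅ SheafOfModules.unit _) := by
  intro σ Ω _ _ s
  haveI := A.isMonHom_mulNDesc u K hK hcov hG hsm hgc hfree
  obtain ⟨Θ, hΘ, hunit⟩ := h σ s
  exact nonempty_pullback_baseChangeToProd_restrict_whiskerRight_iso_unit_of_isLambdaOfAt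
    (X := A.quotientBy u K hcov hG hsm hgc) (A.mulNDesc u K hK hcov) D lam s Θ hΘ (σ : A.Sections) hunit

/-! ## §2 The `hiso₂` binder from the `ē^Θ_n`-isotropy of `K₂` against `K` on geometric fibres -/

include hfree in
/-- **`hiso₂` FROM ISOTROPY OF `K₂` AGAINST `K`** (★ `hiso_of_isLambdaOfAt_of_weilPairingLevel_eq_one` for `σ ∈ K₂`): for the isogeny quotient `ψ : A → A/K`,
`π : A/K → A` (`ψ ≫ π = [n]`, `A` of relative dimension `g`, `n` invertible at geometric points), a dual pair `(Â, 𝒫)`, `λ : A → Â`, and an `n`-torsion subgroup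
`K₂ ≤ A(S)`: if at every geometric point `s̄` there is `Θ` with `λ̄ = Λ(𝒪(Θ))` for which `ē^Θ_n(κ(s̄), σ(s̄)) = 1` for all `κ ∈ K` (and the given `σ ∈ K₂`), then
`(1_{A/K} × λσ(s̄))^*((π × 1_Â)^*𝒫) ≅ 𝒪` — TOKEN FOR TOKEN the `hiso₂` binder of ★ `map_le_poincareStabilizerSubgroup_of_subgroup`.
[cite: MumfordAV1970, §15 Thm. 1 (p. 143) and §23 Thm. 2 (p. 231)] [cite: MilneAV2008, I §9 Thm. 9.1 (p. 42)] -/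
theorem hiso_of_isLambdaOfAt_of_weilPairingLevel_eq_one_of_subgroup (lam : A.X ⟶ D.hat.X) {g : ℕ} (hA : A.IsOfRelDim g)
    (hn : ∀ ⦃Ω : Type u⦄ [Field Ω] [IsAlgClosed Ω] (_ : Spec (.of Ω) ⟶ S), (n : Ω) ≠ 0)
    (K₂ : Subgroup A.Sections) (hK₂ : ∀ σ : K₂, (σ : A.Sections) ^ n = 1)
    (h : ∀ (σ : K₂) ⦃Ω : Type u⦄ [Field Ω] [IsAlgClosed Ω] (s : Spec (.of Ω) ⟶ S),
      ∃ Θ : CartierDivisor (A.fibre s).toAbelianVariety.X.left, A.IsLambdaOfAt s D lam Θ ∧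
        ∀ [IsDominant (AbelianVariety.Hom.toSchemeHom ((n : ℤ) • 𝟙 (A.fibre s).toAbelianVariety))]
          (κ : K) (x y : (A.fibre s).toAbelianVariety.torsionPoints Ω n),
          (x : (A.fibre s).toAbelianVariety.Points Ω) = A.restrictPt s (κ : A.Sections) →
          (y : (A.fibre s).toAbelianVariety.Points Ω) = A.restrictPt s (σ : A.Sections) →
          (A.fibre s).toAbelianVariety.weilPairingLevel Θ x y = 1) :
    ∀ (σ : K₂) ⦃Ω : Type u⦄ [Field Ω] [IsAlgClosed Ω] (s : Spec (.of Ω) ⟶ S),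
      Nonempty ((Scheme.Modules.pullback ((A.quotientBy u K hcov hG hsm hgc).baseChangeToProd D.hat s
          (D.hat.restrict s ((σ : A.Sections) ≫ lam)).left (Over.w _))).obj
        ((Scheme.Modules.pullback ((A.mulNDesc u K hK hcov : (A.quotientBy u K hcov hG hsm hgc).X ⟶ A.X) ▷ D.hat.X).left).obj
          D.P) ≅ SheafOfModules.unit _) := by
  refine A.hiso_of_isLambdaOfAt_of_fibre_of_subgroup u K hK hcov hG hsm hgc D hfree lam K₂ fun σ Ω _ _ s => ?_
  obtain ⟨Θ, hΘ, hiso⟩ := h σ s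
  refine ⟨Θ, hΘ, ?_⟩
  letI : GrpObj (A.quotientOver u K) := (A.quotientBy u K hcov hG hsm hgc).grpObj
  haveI := A.isMonHom_quotientMk u K hcov hG hsm hgc
  haveI := A.isMonHom_mulNDesc u K hK hcov hG hsm hgc hfree
  -- `π_s̄` is an isogeny, hence dominant
  have hisog := A.isIsogeny_fibreHom_quotientMk_and_mulNDesc u K hK hcov hG hsm hgc hfree hA s (hn s)
  haveI : Surjective (AbelianVariety.Hom.toSchemeHom
      (fibreHom (A := A.quotientBy u K hcov hG hsm hgc) (B := A) (A.mulNDesc u K hK hcov) s)) := hisog.2.1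
  -- the kernel of `ψ_s̄` on `Ω`-points is `K(s̄)`
  have hq : ∀ x : A.FibrePoints s, x ≫ A.quotientMk u K hcov = 1 ↔ ∃ τ ∈ (K : Set A.Sections), x = A.restrict s τ := by
    intro x
    rw [A.comp_quotientMk_eq_one_iff u K hcov hG hsm hgc hfree s x]
    exact ⟨fun ⟨τ, hτ⟩ => ⟨τ, τ.2, hτ⟩, fun ⟨τ, hτK, hτ⟩ => ⟨⟨τ, hτK⟩, hτ⟩⟩
  -- the torsion point `σ(s̄)` (`σ ∈ K₂` is killed by `n`)
  let σ' : (A.fibre s).toAbelianVariety.torsionPoints Ω n := ⟨A.restrictPt s (σ : A.Sections), by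
    rw [AbelianVariety.mem_torsionPoints_iff, zpow_natCast]; exact A.restrictPt_pow_eq_one s (hK₂ σ)⟩
  exact nonempty_pullback_translateTensorDual_iso_unit_of_forall_weilPairingLevel_eq_one
    (ψ := fibreHom (A := A) (B := A.quotientBy u K hcov hG hsm hgc) (A.quotientMk u K hcov) s)
    (π := fibreHom (A := A.quotientBy u K hcov hG hsm hgc) (B := A) (A.mulNDesc u K hK hcov) s)
    (hn s) (A.fibreHom_quotientMk_comp_fibreHom_mulNDesc u K hK hcov hG hsm hgc hfree s)
    ((A.fibre s).toAbelianVariety.pow_surjective_of_cast_ne_zero (hn s))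
    (surjective_map_fibreHom_of_forall_fibrePoints s _ (A.quotientBy_ontoFibres u K hcov hG hsm hgc s))
    {P | ∃ τ ∈ (K : Set A.Sections), P = A.restrictPt s τ}
    (fun a ha => (map_fibreHom_eq_one_iff_of_fibrePoints s _ (K : Set A.Sections) hq a).1 ha)
    Θ σ' (fun κ hκ => by
      obtain ⟨τ, hτK, hκτ⟩ := hκ
      exact hiso ⟨τ, hτK⟩ κ σ' hκτ rfl)

end Literature.AlgebraicGeometry.AbelianSchemes.AbelianSchemeOver

end
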